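import Mathlib
import HarnessLib

/-!
# TASK T-S5/U5.4g «Gaussian tail bound» — the tail of an anisotropic Gaussian outside a coordinate box (planner ym-idea-2 g17, BRICK TABLE
# rev 2, 2026-08-29T17:09:25Z; signature 17:07:29Z) — step (1b) of the comparison stubs S5 (LINE-19 ⟨stmt-QuantumFields-24004⟩/⟨24335⟩)
# and U5 (LINE-20 ⟨24336⟩)

Free-hands work of width seat `ym-line-sfw-p2-w3` (g39, cell `ym-idea-1`).  In the Laplace asymptotics of the orbit average `N_h` (T-S5.4,
`Cruxes/BoxWindowHighSU2213/STUB-PLAN-S5U5-STEP1b.md` §3) the Gaussian `exp(−β‖Mv‖²)` (`M = fpOperator`, spectral floor `λ·‖v‖² ≤ ‖Mv‖²` from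
brick 4f) must be negligible outside the inner region `{∀ i, |v i| < ρ}` where the cut-off is `1`; this file gives the tail in closed form:

  `∫_{∃ i, ρ ≤ |v i|} exp(−β‖Mv‖²) dv ≤ e^{−βλρ²/2} · √(2π/(βλ))ⁿ`

(pointwise `exp(−β‖Mv‖²) ≤ e^{−βλρ²/2}·e^{−(βλ/2)‖v‖²}` on the tail set since `‖v‖² ≥ (v i)² ≥ ρ²`, then the product Gaussian integral
`∫ e^{−(βλ/2)‖v‖²} = √(π/(βλ/2))ⁿ`, Mathlib `integral_gaussian` + `integral_fintype_prod_volume_eq_pow`).  The Prop `GaussianTailBound` is the planner's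
17:07:29Z text VERBATIM except that the binder `λ` (a Lean keyword) is spelled `lam`.  Mathlib only; no `sorry`.

HONEST LABEL: an S–M brick of step (1b); T-S5.4 proper, S5, U5, ⟨24004⟩ ⟨24335⟩ ⟨24336⟩ remain OPEN; no crux, rung or summit is proved; the
Yang–Mills mass gap is NOT proved by this file.
-/

set_option autoImplicit false

noncomputable section

open MeasureTheory Matrix Real Finset Filter

namespace Summit.QuantumFields.YangMills.Theorems.AllWindowsColdBoxBoxHighLine

/-- T-S5.4g **(Gaussian tail bound; S–M)**: for a real `n × n` matrix `M` with `λ‖v‖² ≤ ‖Mv‖²` (`λ > 0`), `β > 0` and `ρ ≥ 0`,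
`∫_{∃ i, ρ ≤ |v i|} exp(−β‖Mv‖²) dv ≤ e^{−βλρ²/2} · √(2π/(βλ))ⁿ` (planner ym-idea-2 g17, 2026-08-29T17:07:29Z, verbatim with `λ ↦ lam`). -/
def GaussianTailBound : Prop :=
  ∀ (n : ℕ) (M : Matrix (Fin n) (Fin n) ℝ) (lam : ℝ), 0 < lam → (∀ v, lam * (v ⬝ᵥ v) ≤ M.mulVec v ⬝ᵥ M.mulVec v) →
    ∀ β ρ : ℝ, 0 < β → 0 ≤ ρ →
      ∫ v in {v : Fin n → ℝ | ∃ i, ρ ≤ |v i|}, Real.exp (-(β * (M.mulVec v ⬝ᵥ M.mulVec v)))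
        ≤ Real.exp (-(β * lam * ρ ^ 2 / 2)) * Real.sqrt (2 * Real.pi / (β * lam)) ^ n

/-! ## Lemmas -/

/-- `v ⬝ᵥ v = Σ (v i)²` dominates each coordinate square. -/
theorem sq_le_dotProduct_self {n : ℕ} (v : Fin n → ℝ) (i : Fin n) : v i ^ 2 ≤ v ⬝ᵥ v := by
  rw [dotProduct]
  have : v i ^ 2 = v i * v i := sq (v i)
  rw [this]
  exact Finset.single_le_sum (f := fun j => v j * v j) (fun j _ => mul_self_nonneg (v j)) (Finset.mem_univ i)

/-- The product Gaussian `v ↦ ∏ i, exp(−b (v i)²)` is `exp(−b · v⬝ᵥv)`. -/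
theorem prod_exp_neg_mul_sq {n : ℕ} (b : ℝ) (v : Fin n → ℝ) :
    ∏ i, Real.exp (-b * v i ^ 2) = Real.exp (-(b * (v ⬝ᵥ v))) := by
  rw [← Real.exp_sum, dotProduct, Finset.mul_sum, ← Finset.sum_neg_distrib]
  congr 1
  refine Finset.sum_congr rfl fun i _ => ?_
  ring

/-- The product Gaussian is integrable on `Fin n → ℝ` for `b > 0`. -/
theorem integrable_exp_neg_mul_dotProduct {n : ℕ} {b : ℝ} (hb : 0 < b) :
    Integrable (fun v : Fin n → ℝ => Real.exp (-(b * (v ⬝ᵥ v)))) := by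
  have h := Integrable.fintype_prod (ι := Fin n) (μ := fun _ : Fin n => (volume : Measure ℝ))
    (f := fun _ : Fin n => fun x : ℝ => Real.exp (-b * x ^ 2)) (fun _ => integrable_exp_neg_mul_sq hb)
  simp_rw [prod_exp_neg_mul_sq] at h
  exact h

/-- The product Gaussian integral: `∫ exp(−b · v⬝ᵥv) dv = √(π/b)ⁿ`. -/
theorem integral_exp_neg_mul_dotProduct {n : ℕ} (b : ℝ) :
    ∫ v : Fin n → ℝ, Real.exp (-(b * (v ⬝ᵥ v))) = Real.sqrt (Real.pi / b) ^ n := by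
  have h := MeasureTheory.integral_fintype_prod_volume_eq_pow (ι := Fin n) (fun x : ℝ => Real.exp (-b * x ^ 2))
  simp_rw [prod_exp_neg_mul_sq] at h
  rw [h, integral_gaussian, Fintype.card_fin]

/-- The tail set `{∃ i, ρ ≤ |v i|}` is measurable (a finite union of closed sets). -/
theorem measurableSet_tail {n : ℕ} (ρ : ℝ) : MeasurableSet {v : Fin n → ℝ | ∃ i, ρ ≤ |v i|} := by
  have : {v : Fin n → ℝ | ∃ i, ρ ≤ |v i|} = ⋃ i : Fin n, {v : Fin n → ℝ | ρ ≤ |v i|} := by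
    ext v; simp
  rw [this]
  refine MeasurableSet.iUnion fun i => ?_
  exact (isClosed_le continuous_const ((continuous_apply i).abs)).measurableSet

/-! ## The brick -/

/-- ★ **T-S5.4g «GAUSSIAN TAIL BOUND», BY NAME.** [folklore] -/
theorem gaussianTailBound : GaussianTailBound := by
  intro n M lam hlam hM β ρ hβ hρ
  set S : Set (Fin n → ℝ) := {v : Fin n → ℝ | ∃ i, ρ ≤ |v i|} with hS
  set b : ℝ := β * lam / 2 with hb
  have hbpos : 0 < b := by rw [hb]; positivity
  -- the integrand, its majorants
  set f : (Fin n → ℝ) → ℝ := fun v => Real.exp (-(β * (M.mulVec v ⬝ᵥ M.mulVec v))) with hf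
  set g : (Fin n → ℝ) → ℝ := fun v => Real.exp (-(β * lam * ρ ^ 2 / 2)) * Real.exp (-(b * (v ⬝ᵥ v))) with hg
  have hg_int : Integrable g := (integrable_exp_neg_mul_dotProduct hbpos).const_mul _
  -- `f ≤ exp(−βλ‖v‖²)` everywhere (integrability) and `f ≤ g` on the tail set
  have hf_le : ∀ v, f v ≤ Real.exp (-(β * lam * (v ⬝ᵥ v))) := fun v => by
    simp only [hf]
    refine Real.exp_le_exp.2 ?_
    have := hM v
    nlinarith
  have hf_cont : Continuous f := by
    simp only [hf]
    fun_prop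
  have hf_int : Integrable f := by
    have hβlam : 0 < β * lam := mul_pos hβ hlam
    refine (integrable_exp_neg_mul_dotProduct hβlam).mono' hf_cont.aestronglyMeasurable (Eventually.of_forall fun v => ?_)
    rw [Real.norm_eq_abs, abs_of_pos (Real.exp_pos _)]
    exact hf_le v
  have hfg : ∀ v ∈ S, f v ≤ g v := by
    intro v hv
    obtain ⟨i, hi⟩ := hv
    have hvi : ρ ^ 2 ≤ v ⬝ᵥ v := by
      have h1 : ρ ^ 2 ≤ v i ^ 2 := by
        rw [← sq_abs (v i)]
        exact pow_le_pow_left₀ hρ hi 2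
      exact h1.trans (sq_le_dotProduct_self v i)
    simp only [hf, hg, hb]
    rw [← Real.exp_add]
    refine Real.exp_le_exp.2 ?_
    have := hM v
    have hβlam : 0 ≤ β * lam := (mul_pos hβ hlam).le
    nlinarith
  -- assemble
  calc ∫ v in S, f v ≤ ∫ v in S, g v :=
        setIntegral_mono_on hf_int.integrableOn hg_int.integrableOn (measurableSet_tail ρ) hfg
    _ ≤ ∫ v, g v := setIntegral_le_integral hg_int (Eventually.of_forall fun v => by simp only [hg]; positivity)
    _ = Real.exp (-(β * lam * ρ ^ 2 / 2)) * Real.sqrt (Real.pi / b) ^ n := by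
        simp only [hg]
        rw [integral_const_mul, integral_exp_neg_mul_dotProduct]
    _ = Real.exp (-(β * lam * ρ ^ 2 / 2)) * Real.sqrt (2 * Real.pi / (β * lam)) ^ n := by
        congr 2
        rw [hb]
        congr 1
        field_simp

end Summit.QuantumFields.YangMills.Theorems.AllWindowsColdBoxBoxHighLine

end
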